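import Literature.Analysis.FluidPDE.BilliardTensorMeasure
import HarnessLib

/-!
# The spatial trace mass of Serre's billiard tensor measure: (17)

Companion of `Literature.Analysis.FluidPDE.BilliardTensorMeasure` (Serre's mass–momentum tensor
with collitons `M = billiardTensor ε γ a b` as a matrix-valued measure on `ℝ × T^d`). Here its
spatial trace mass is computed (Serre 2024 §5 (17): `‖Tr_d M‖ = 2 E T + 2a Σ_coll |[v]|`):

* `IsHardSphereTrajectory.sum_particleTensor_diag_univ` — the particle part contributes
  `2 E (b - a)` (`Σ_i v_i² = |v|²`, `Σ_p |v_p|² = 2E` conserved);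
* `IsHardSphereTrajectory.sum_collitonEntryAt_diag_univ` — a collision contributes
  `ε |Δv_i| = (ε/2) velocityJump γ t`;
* **`IsHardSphereTrajectory.spatialTraceMass_billiardTensor`** —
  `Σ_i M_{ii}(univ) = 2 E (b - a) + (ε/2) Σᶠ_{t_c ∈ (a,b]} velocityJump γ t_c`, which is the
  tested value `stTracePairing ε 1 γ a b` of `BilliardTensorTrace`
  (`spatialTraceMass_billiardTensor_eq_stTracePairing`).

## References

* D. Serre, *Compensated integrability on tori; a priori estimate for space-periodic gas flows*,
  C. R. Math. Acad. Sci. Paris 362 (2024) 1425–1444, §5 (17), p. 1439. [Serre2024]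
-/

open Set Filter Function MeasureTheory
open scoped InnerProductSpace Topology

namespace Literature.Analysis.FluidPDE

noncomputable section

open Literature.Analysis.FunctionSpaces

variable {d : Type*} [Fintype d] {N : ℕ}

namespace IsHardSphereTrajectory

variable {ε : ℝ} {γ : ℝ → Config N d (UnitAddTorus d)}

/-- The spatial trace of the particle part over the window is `2 E (b - a)`
(`Σ_i v_i² = |v|²`, `Σ_p |v_p|² = 2E` conserved). [cite: Serre2024, §5 (17)] -/
theorem sum_particleTensor_diag_univ (h : IsHardSphereTrajectory (Torus.geometry d) ε N γ) {a b : ℝ}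
    (hab : a ≤ b) :
    ∑ i : d, particleTensor γ a b (some i) (some i) univ = 2 * configEnergy (γ a) * (b - a) := by
  classical
  have hentry : ∀ (i : d) (p : Fin N), particleEntry γ a b p (some i) (some i) univ =
      ∫ t in Icc a b, (γ t p).2 i ^ 2 := by
    intro i p
    rw [h.particleEntry_apply a b p _ _ MeasurableSet.univ, preimage_univ, inter_univ]
    refine setIntegral_congr_fun measurableSet_Icc fun t _ => ?_
    simp only [particleDensity, stVec_some, sq]
  have hint : ∀ (i : d) (p : Fin N), IntegrableOn (fun t => (γ t p).2 i ^ 2) (Icc a b) volume := by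
    intro i p
    have := h.integrable_particleDensity p (some i) (some i) a b
    refine (this.congr (Eventually.of_forall fun t => ?_))
    simp only [particleDensity, stVec_some, sq]
  calc ∑ i : d, particleTensor γ a b (some i) (some i) univ
      = ∑ i : d, ∑ p : Fin N, ∫ t in Icc a b, (γ t p).2 i ^ 2 := by
        refine Finset.sum_congr rfl fun i _ => ?_
        rw [particleTensor, Matrix.of_apply, signedMeasure_sum_apply]
        exact Finset.sum_congr rfl fun p _ => hentry i p
    _ = ∫ t in Icc a b, ∑ i : d, ∑ p : Fin N, (γ t p).2 i ^ 2 := by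
        rw [integral_finsetSum _ fun i _ => integrable_finsetSum _ fun p _ => hint i p]
        exact Finset.sum_congr rfl fun i _ => (integral_finsetSum _ fun p _ => hint i p).symm
    _ = ∫ t in Icc a b, 2 * configEnergy (γ a) := by
        refine setIntegral_congr_fun measurableSet_Icc fun t _ => ?_
        rw [Finset.sum_comm, IsHardSphereTrajectory.configEnergy_eq_holds h a t]
        simp only [configEnergy, EuclideanSpace.real_norm_sq_eq, Finset.mul_sum]
        exact Finset.sum_congr rfl fun p _ => by ring
    _ = 2 * configEnergy (γ a) * (b - a) := by
        rw [setIntegral_const, Measure.real, Real.volume_Icc, ENNReal.toReal_ofReal (sub_nonneg.2 hab),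
          smul_eq_mul]
        ring

/-- The spatial trace of the colliton entries at a collision time is `ε |Δv_i| =
(ε/2) velocityJump γ t`. [cite: Serre2024, §5 (17)] -/
theorem sum_collitonEntryAt_diag_univ (h : IsHardSphereTrajectory (Torus.geometry d) ε N γ)
    {t : ℝ} {i j : Fin N} (hij : i ≠ j) (hc : γ t ∈ contactSet (Torus.geometry d) N ε i j) :
    ∑ k : d, collitonEntryAt ε γ t (some k) (some k) univ = 2⁻¹ * ε * velocityJump γ t := by
  classical
  have hpair : ∀ p : Fin N × Fin N, ∑ k : d,
      (collitonWeight ε (leftLim γ t) (γ t) p.1 (some k) (some k) •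
        collitonSegment t (γ t p.2).1 ((Torus.geometry d).sepVec (γ t p.1).1 (γ t p.2).1)) univ =
      2⁻¹ * ε * ‖(γ t p.1).2 - (leftLim γ t p.1).2‖ := by
    intro p
    set v : EuclideanSpace ℝ d := (γ t p.1).2 - (leftLim γ t p.1).2 with hv
    simp only [FunLike.coe_smul, Pi.smul_apply, collitonSegment_univ, smul_eq_mul, mul_one,
      collitonWeight, stVec_some, ← Finset.mul_sum, ← hv]
    by_cases h0 : ‖v‖ = 0
    · simp [h0]
    · field_simp
      rw [EuclideanSpace.real_norm_sq_eq]
  calc ∑ k : d, collitonEntryAt ε γ t (some k) (some k) univ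
      = ∑ p ∈ collidingPairs (Torus.geometry d) ε (γ t), ∑ k : d,
          (collitonWeight ε (leftLim γ t) (γ t) p.1 (some k) (some k) •
            collitonSegment t (γ t p.2).1 ((Torus.geometry d).sepVec (γ t p.1).1 (γ t p.2).1)) univ := by
        simp only [collitonEntryAt, signedMeasure_sum_apply]
        rw [Finset.sum_comm]
    _ = ∑ p ∈ collidingPairs (Torus.geometry d) ε (γ t), 2⁻¹ * ε * ‖(γ t p.1).2 - (leftLim γ t p.1).2‖ :=
        Finset.sum_congr rfl fun p _ => hpair p
    _ = 2⁻¹ * ε * velocityJump γ t := by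
        rw [h.sum_collidingPairs_eq hij hc, h.vel_sub_leftLim_right_eq_neg hij hc, norm_neg,
          h.velocityJump_eq hij hc]
        ring

/-- **Serre's (17) for the measure `M`**: the spatial trace mass of the mass–momentum tensor with
collitons over the window is `2 E (b - a) + (ε/2) Σᶠ_{t_c ∈ (a,b]} velocityJump γ t_c`
(`= 2ET + 2aΣ_coll |[v]|` in Serre's notation), i.e. the tested value `stTracePairing ε 1 γ a b`
of `BilliardTensorTrace`. [cite: Serre2024, §5 (17)] -/
theorem spatialTraceMass_billiardTensor (h : IsHardSphereTrajectory (Torus.geometry d) ε N γ)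
    {a b : ℝ} (hab : a ≤ b) :
    ∑ i : d, billiardTensor ε γ a b (some i) (some i) univ =
      2 * configEnergy (γ a) * (b - a) +
        2⁻¹ * ε * ∑ᶠ t ∈ collisionTimes (Torus.geometry d) ε γ ∩ Ioc a b, velocityJump γ t := by
  classical
  have hfin := h.finite_collisionTimes_inter_Ioc a b
  have hcoll : ∑ i : d, collitonTensor ε γ a b (some i) (some i) univ =
      2⁻¹ * ε * ∑ᶠ t ∈ collisionTimes (Torus.geometry d) ε γ ∩ Ioc a b, velocityJump γ t := by
    rw [finsum_mem_eq_finite_toFinset_sum _ hfin, Finset.mul_sum]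
    calc ∑ i : d, collitonTensor ε γ a b (some i) (some i) univ
        = ∑ i : d, ∑ t ∈ hfin.toFinset, collitonEntryAt ε γ t (some i) (some i) univ := by
          refine Finset.sum_congr rfl fun i _ => ?_
          rw [collitonTensor, Matrix.of_apply, finsum_mem_eq_finite_toFinset_sum _ hfin,
            signedMeasure_sum_apply]
      _ = ∑ t ∈ hfin.toFinset, ∑ i : d, collitonEntryAt ε γ t (some i) (some i) univ := Finset.sum_comm
      _ = ∑ t ∈ hfin.toFinset, 2⁻¹ * ε * velocityJump γ t := by
          refine Finset.sum_congr rfl fun t ht => ?_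
          obtain ⟨⟨i, j, hij, hc⟩, -⟩ := (Set.Finite.mem_toFinset _).1 ht
          exact h.sum_collitonEntryAt_diag_univ hij hc
  simp only [billiardTensor, Matrix.add_apply, FunLike.coe_add, Pi.add_apply, Finset.sum_add_distrib,
    h.sum_particleTensor_diag_univ hab, hcoll]

/-- The spatial trace mass of `M` is the tested trace pairing with the constant `1`. [folklore] -/
theorem spatialTraceMass_billiardTensor_eq_stTracePairing
    (h : IsHardSphereTrajectory (Torus.geometry d) ε N γ) {a b : ℝ} (hab : a ≤ b) :
    ∑ i : d, billiardTensor ε γ a b (some i) (some i) univ = stTracePairing ε (fun _ _ => (1 : ℝ)) γ a b := by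
  rw [h.spatialTraceMass_billiardTensor hab, h.stTracePairing_one a b]

end IsHardSphereTrajectory

end

end Literature.Analysis.FluidPDE
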